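import Literature.Geometry.Lorentzian.LocalTimeSeparationContinuous
import Literature.Geometry.Lorentzian.RadialCausalCone
import Literature.Geometry.Lorentzian.ConvergenceTransport
import HarnessLib

/-!
# The level function of the local time separation and its gradient (Sbierski 2016, §3.2, proof
# of Thm. 12: "`S` is smooth … by the Gauss lemma the normal of `S` is timelike")

J. Sbierski, Ann. Henri Poincaré 17 (2016) 301–329 = arXiv:1309.7591v3, §3.2, proof of Thm. 12:
the time separation from a point `q`, written on a causally convex normal neighbourhood as
`τ_q(r) = √(-g|_q(exp_q⁻¹ r, exp_q⁻¹ r))`, is *"smooth in `I⁻(q) ∩ W`"*, and its level set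
`S = τ_q⁻¹(τ₀)` is smooth with timelike normal *"`(exp_q)_*(X)`"* by the Gauss lemma. In the
tree's language (two-point inverse `Ξ` of `exp` on a uniformly normal neighbourhood `W` read
through the trivialisation `e` of `TM` at the centre `c`, as exported by
`exists_nhds_continuousOn_lorentzDist`; radial vector `w(r) = e⁻¹_q(Ξ q r) = exp_q⁻¹ r`) we
consider the **level function** `f(r) = a - √(-g_q(w r, w r))` for a constant `a` and prove:

* `LorentzianMetric.contMDiffOn_levelFun` — `f` is `C^∞` on the open set of points `r ∈ W` with
  `g_q(w r, w r) < 0`;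
* `LorentzianMetric.mfderiv_levelFun_pos` — **at a point `p₀ ∈ W` whose radial vector `w p₀` is
  past timelike, `df_{p₀}(v) > 0` for every future-directed `v ∈ T_{p₀}M`**: along the radial
  geodesic `α(u) = exp_{p₀}(u v)` one has `d g_q(w ∘ α, w ∘ α)/du = 2 g(α', P)` by the Gauss lemma
  (`val_deriv_self_eq_val_velocity_radial`), where `P`, the velocity of the past timelike radial
  geodesic from `q` through `p₀`, is past timelike, so `g(v, P) > 0`; hence
  `d f(α u)/du = g(v, P)/√(-g_q(w p₀, w p₀)) > 0`.

This is the hypothesis (H2) ("`f p₀ = 0` and differential positive on the future causal cone")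
of the restart of the local uniqueness theorem
(`Summit.FinalStateConjecture.….SubdataDevelopmentsEmbed.restart_of_locallyUnique`) for
`f = τ₀ - τ_q`. Everything is proved; no definitions, no named facts (D-0026).

## References

* J. Sbierski, Ann. Henri Poincaré 17 (2016) 301–329 = arXiv:1309.7591v3, §3.2, proof of Thm. 12
  (arXiv numbering). [Sbierski2016AHP]
* B. O'Neill, *Semi-Riemannian geometry with applications to relativity*, Academic Press 1983,
  Ch. 5, Lemma 5.1 (Gauss lemma), Cor. 5.3, Lemma 5.33. [ONeillSemiRiemannian1983]
-/

noncomputable section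

open Bundle Set Filter Function
open scoped Manifold ContDiff Topology

namespace Literature.Geometry.Lorentzian

open Literature.Geometry.Riemannian

variable {E : Type*} [NormedAddCommGroup E] [NormedSpace ℝ E] {H : Type*} [TopologicalSpace H]
  {I : ModelWithCorners ℝ E H} {M : Type*} [TopologicalSpace M] [ChartedSpace H M]
  [IsManifold I ∞ M]

namespace LorentzianMetric

variable [FiniteDimensional ℝ E] [CompleteSpace E] [T2Space M] [I.Boundaryless]
  {n : ℕ∞ω} {g : LorentzianMetric I n M} [g.HasLeviCivita]
  [CovariantDerivative.ContMDiffCovariantDerivative g.leviCivita 1] (τ : TimeOrientation g)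

omit [IsManifold I ∞ M] [FiniteDimensional ℝ E] [CompleteSpace E] [T2Space M] [I.Boundaryless]
  [g.HasLeviCivita] [CovariantDerivative.ContMDiffCovariantDerivative g.leviCivita 1] in
/-- **The radial vector `w(r) = L (Ξ q r)` is smooth on `W`** (as a map into the model space),
for a two-point map `Ξ` smooth on `W × W`, `q ∈ W` and a continuous linear `L` (the inverse
trivialisation `e⁻¹_q`). [folklore] -/
theorem contMDiffOn_clm_twoPoint (L : E →L[ℝ] E) {W : Set M} {Ξ : M → M → E}
    (hΞs : ContMDiffOn (I.prod I) 𝓘(ℝ, E) ∞ (uncurry Ξ) (W ×ˢ W)) {q : M} (hqW : q ∈ W) :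
    ContMDiffOn I 𝓘(ℝ, E) ∞ (fun r ↦ L (Ξ q r)) W := by
  have h1 : ContMDiff I (I.prod I) ∞ (fun r : M ↦ (q, r)) := contMDiff_const.prodMk contMDiff_id
  have h2 : ContMDiffOn I 𝓘(ℝ, E) ∞ (fun r ↦ Ξ q r) W :=
    hΞs.comp h1.contMDiffOn fun r hr ↦ ⟨hqW, hr⟩
  exact L.contMDiff.comp_contMDiffOn h2

omit [FiniteDimensional ℝ E] [CompleteSpace E] [T2Space M] [I.Boundaryless] [g.HasLeviCivita]
  [CovariantDerivative.ContMDiffCovariantDerivative g.leviCivita 1] in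
/-- **The level function `f(r) = a - √(-g_q(w r, w r))` of the local time separation is smooth
where `g_q(w r, w r) < 0`** (`w` the radial vector of a smooth two-point map; the quadratic form is
smooth, `√` is smooth away from `0`). Sbierski 2016, §3.2, proof of Thm. 12 ("`τ_q` is smooth in
`I⁻(q) ∩ W`"). [cite: Sbierski2016AHP, §3.2, proof of Thm. 12 (arXiv numbering)] -/
theorem contMDiffOn_levelFun (c : M) {W : Set M} {Ξ : M → M → E} (hWo : IsOpen W)
    (hΞs : ContMDiffOn (I.prod I) 𝓘(ℝ, E) ∞ (uncurry Ξ) (W ×ˢ W)) {q : M} (hqW : q ∈ W) (a : ℝ) :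
    ContMDiffOn I 𝓘(ℝ, ℝ) ∞
      (fun r ↦ a - Real.sqrt (-g.val q
        ((trivializationAt E (TangentSpace I : M → Type _) c).symmL ℝ q (Ξ q r))
        ((trivializationAt E (TangentSpace I : M → Type _) c).symmL ℝ q (Ξ q r))))
      {r ∈ W | g.val q ((trivializationAt E (TangentSpace I : M → Type _) c).symmL ℝ q (Ξ q r))
        ((trivializationAt E (TangentSpace I : M → Type _) c).symmL ℝ q (Ξ q r)) < 0} := by
  set e := trivializationAt E (TangentSpace I : M → Type _) c with he
  set L : E →L[ℝ] E := e.symmL ℝ q with hL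
  set w : M → E := fun r ↦ L (Ξ q r) with hw
  have hws : ContMDiffOn I 𝓘(ℝ, E) ∞ w W := contMDiffOn_clm_twoPoint L hΞs hqW
  -- the quadratic form `u ↦ g_q(u, u)` is smooth on the model space
  set B : E →L[ℝ] E →L[ℝ] ℝ := g.val q with hB
  have hBs : ContDiff ℝ ∞ (fun u : E ↦ B u u) :=
    (B.contDiff).clm_apply contDiff_id
  set Q : M → ℝ := fun r ↦ B (w r) (w r) with hQdef
  intro r hr
  have hrW : r ∈ W := hr.1
  have hneg : -Q r ≠ 0 := by
    have h : Q r < 0 := hr.2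
    linarith
  -- `r ↦ -g_q(w r, w r)` is smooth at `r`
  have hQ : ContMDiffAt I 𝓘(ℝ, ℝ) ∞ (fun r ↦ -Q r) r := by
    have h1 : ContMDiffAt I 𝓘(ℝ, E) ∞ w r := hws.contMDiffAt (hWo.mem_nhds hrW)
    have h2 : ContMDiffAt I 𝓘(ℝ, ℝ) ∞ ((fun u : E ↦ B u u) ∘ w) r := hBs.comp_contMDiffAt h1
    exact h2.neg
  have hsqrt : ContMDiffAt I 𝓘(ℝ, ℝ) ∞ ((fun x : ℝ ↦ Real.sqrt x) ∘ fun r ↦ -Q r) r :=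
    ContDiffAt.comp_contMDiffAt (f := fun r ↦ -Q r) (x := r) (Real.contDiffAt_sqrt hneg) hQ
  exact (contMDiffAt_const.sub hsqrt).contMDiffWithinAt

/-- **The differential of the level function is positive on the future causal cone** (Sbierski
2016, §3.2, proof of Thm. 12: *"it follows from the Gauss lemma that the normal of `S` at
`exp_q(X)` … is given by `(exp_q)_*(X)`, which is timelike"*). Let `Ξ` be a smooth two-point
inverse of `exp` on the open `W ∋ q` (`exp_p (e⁻¹_p (Ξ p z)) = z`, `e⁻¹_p (Ξ p z) ∈ 𝓔_p` for
`p, z ∈ W`), `p₀ ∈ W` a point whose radial vector `w p₀ = e⁻¹_q(Ξ q p₀)` is past timelike, and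
`f(r) = a - √(-g_q(w r, w r))`. Then `0 < df_{p₀}(v)` for every future-directed `v ∈ T_{p₀}M`.
See the module docstring for the computation. [cite: Sbierski2016AHP, §3.2, proof of Thm. 12 (arXiv numbering)]
[cite: ONeillSemiRiemannian1983, Ch. 5, Lemma 5.1 and Lemma 5.33] -/
theorem mfderiv_levelFun_pos (hn : (∞ : ℕ∞ω) ≤ n) (c : M) {W : Set M} {Ξ : M → M → E}
    (hWo : IsOpen W) (hΞs : ContMDiffOn (I.prod I) 𝓘(ℝ, E) ∞ (uncurry Ξ) (W ×ˢ W))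
    (hΞ : ∀ p ∈ W, ∀ z ∈ W,
      ((trivializationAt E (TangentSpace I : M → Type _) c).symmL ℝ p (Ξ p z) :
          TangentSpace I p) ∈ expDomain g.leviCivita p ∧
        expMap g.leviCivita p
          ((trivializationAt E (TangentSpace I : M → Type _) c).symmL ℝ p (Ξ p z)) = z)
    {q p₀ : M} (hqW : q ∈ W) (hp₀W : p₀ ∈ W)
    (hwt : g.IsTimelike (x := q)
      ((trivializationAt E (TangentSpace I : M → Type _) c).symmL ℝ q (Ξ q p₀)))
    (hwp : τ.IsPastDirected (x := q)
      ((trivializationAt E (TangentSpace I : M → Type _) c).symmL ℝ q (Ξ q p₀)))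
    (a : ℝ) {v : TangentSpace I p₀} (hv : τ.IsFutureDirected v) :
    (0 : ℝ) < mfderiv I 𝓘(ℝ, ℝ)
      (fun r ↦ a - Real.sqrt (-g.val q
        ((trivializationAt E (TangentSpace I : M → Type _) c).symmL ℝ q (Ξ q r))
        ((trivializationAt E (TangentSpace I : M → Type _) c).symmL ℝ q (Ξ q r)))) p₀ v := by
  haveI : Fact (1 ≤ n) := ⟨le_trans (by exact_mod_cast le_top) hn⟩
  set cov := g.leviCivita with hcov
  set e := trivializationAt E (TangentSpace I : M → Type _) c with he
  set L : E →L[ℝ] E := e.symmL ℝ q with hL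
  set w : M → E := fun r ↦ L (Ξ q r) with hw
  set B : E →L[ℝ] E →L[ℝ] ℝ := g.val q with hB
  have hBs : ContDiff ℝ ∞ (fun u : E ↦ B u u) := (B.contDiff).clm_apply contDiff_id
  set Q : M → ℝ := fun r ↦ B (w r) (w r) with hQ
  set f : M → ℝ := fun r ↦ a - Real.sqrt (-Q r) with hf
  have hws : ContMDiffOn I 𝓘(ℝ, E) ∞ w W := contMDiffOn_clm_twoPoint L hΞs hqW
  have hwexp : ∀ z ∈ W, expMap cov q (w z : TangentSpace I q) = z := fun z hz ↦ (hΞ q hqW z hz).2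
  have hwdom : ∀ z ∈ W, (w z : TangentSpace I q) ∈ expDomain cov q := fun z hz ↦ (hΞ q hqW z hz).1
  have hQ₀ : Q p₀ < 0 := hwt
  have hQ₀' : 0 < -Q p₀ := by linarith
  -- `f` is smooth near `p₀`
  have hO : IsOpen {r ∈ W | Q r < 0} := by
    have hQc : ContinuousOn Q W := hBs.continuous.comp_continuousOn hws.continuousOn
    exact hQc.isOpen_inter_preimage hWo isOpen_Iio
  have hfs : ContMDiffOn I 𝓘(ℝ, ℝ) ∞ f {r ∈ W | Q r < 0} := contMDiffOn_levelFun (g := g) c hWo hΞs hqW a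
  have hfd : MDifferentiableAt I 𝓘(ℝ, ℝ) f p₀ :=
    (hfs.contMDiffAt (hO.mem_nhds ⟨hp₀W, hQ₀⟩)).mdifferentiableAt (by simp)
  -- the radial geodesic `α` from `p₀` with velocity `v`
  set α : ℝ → M := fun u ↦ expMap cov p₀ (u • v) with hα
  obtain ⟨hmaxα, h0Dα, -, -⟩ := maximalGeodesic_spec' (cov := cov) p₀ v
  have hα0 : α 0 = p₀ := by simp only [hα, zero_smul]; exact expMap_zero (cov := cov) p₀
  have hαd : MDifferentiableAt 𝓘(ℝ, ℝ) I α 0 :=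
    IsGeodesicOn.mdifferentiableAt_holds (isGeodesicOn_expMap_smul (cov := cov) p₀ v) h0Dα
  have hαv : velocity I α 0 = v := velocity_expMap_smul_zero (cov := cov) p₀ v
  have hαc : ContinuousAt α 0 := hαd.continuousAt
  -- `β = w ∘ α`, differentiable at `0`, `exp_q ∘ β = α` near `0`
  set β : ℝ → E := fun u ↦ w (α u) with hβ
  have hβ0 : β 0 = w p₀ := by simp only [hβ, hα0]
  have hβd : HasDerivAt β (deriv β 0) 0 := by
    have h1 : MDifferentiableAt I 𝓘(ℝ, E) w (α 0) := by
      rw [hα0]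
      exact (hws.contMDiffAt (hWo.mem_nhds hp₀W)).mdifferentiableAt (by simp)
    have h := h1.comp 0 hαd
    exact (mdifferentiableAt_iff_differentiableAt.1 h).hasDerivAt
  have hαW : ∀ᶠ u in 𝓝 (0 : ℝ), α u ∈ W := hαc.preimage_mem_nhds (by rw [hα0]; exact hWo.mem_nhds hp₀W)
  have hexpβ : (fun u ↦ expMap cov q (β u : TangentSpace I q)) =ᶠ[𝓝 0] α := by
    filter_upwards [hαW] with u hu using hwexp (α u) hu
  -- the derivative of `Q ∘ α` at `0` is `2 g_q(β', β 0) = 2 g(α'(0), P)` (Gauss lemma)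
  have hQα : HasDerivAt (fun u ↦ Q (α u)) (2 * g.val q (deriv β 0) (β 0)) 0 :=
    hasDerivAt_val_self_comp q hβd
  have hβ0dom : (β 0 : TangentSpace I q) ∈ expDomain cov q := by rw [hβ0]; exact hwdom p₀ hp₀W
  have hgauss := val_deriv_self_eq_val_velocity_radial hn q hβd hβ0dom
  -- the radial velocity `P` at `p₀` is past timelike, `α'(0) = v` is future causal: `g(v, P) > 0`
  have hrhs : 0 < g.val (expMap cov q (β 0 : TangentSpace I q))
      (velocity I (fun s ↦ expMap cov q (β s : TangentSpace I q)) 0)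
      (velocity I (fun r : ℝ ↦ expMap cov q ((r • β 0 : E) : TangentSpace I q)) 1) := by
    rw [velocity_congr_of_eventuallyEq (I := I) hexpβ]
    -- `P` is future timelike for the reversed time orientation
    have h1D : (1 : ℝ) ∈ maximalGeodesicDomain cov q (β 0 : TangentSpace I q) := hβ0dom.2
    have hwt' : g.IsTimelike (x := q) (β 0) := by rw [hβ0]; exact hwt
    have hwf' : τ.reverse.IsFutureDirected (x := q) (β 0) := by
      rw [hβ0, TimeOrientation.isFutureDirected_reverse_iff]; exact hwp
    have hP := isTimelike_isFutureDirected_velocity_expMap_smul τ.reverse hwt' hwf' h1D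
    -- `-v` is future-directed for the reversed orientation
    have hv' : τ.reverse.IsFutureDirected (x := p₀) (-v) := by
      rw [TimeOrientation.isFutureDirected_reverse_iff, ← TimeOrientation.isFutureDirected_neg_iff,
        neg_neg]
      exact hv
    have hpt : expMap cov q ((1 : ℝ) • (β 0 : E) : TangentSpace I q) = p₀ := by
      rw [one_smul, hβ0]; exact hwexp p₀ hp₀W
    have hb : expMap cov q (β 0 : TangentSpace I q) = p₀ := by rw [hβ0]; exact hwexp p₀ hp₀W
    -- the radial velocity `P`, read at the point `p₀`
    have hP₀ : g.IsTimelike (x := p₀)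
        (velocity I (fun r : ℝ ↦ expMap cov q ((r • β 0 : E) : TangentSpace I q)) 1) ∧
        τ.reverse.IsFutureDirected (x := p₀)
        (velocity I (fun r : ℝ ↦ expMap cov q ((r • β 0 : E) : TangentSpace I q)) 1) := by
      constructor
      · convert hP.1 using 2 <;> first | exact hpt.symm | rfl
      · convert hP.2 using 2 <;> first | exact hpt.symm | rfl
    have key : g.val p₀ (velocity I (fun r : ℝ ↦ expMap cov q ((r • β 0 : E) : TangentSpace I q)) 1)
        (-v) < 0 := hP₀.2.val_lt_zero τ.reverse hP₀.1 hv'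
    rw [map_neg, neg_lt_zero] at key
    have key' : 0 < g.val p₀ (velocity I α 0)
        (velocity I (fun r : ℝ ↦ expMap cov q ((r • β 0 : E) : TangentSpace I q)) 1) := by
      rw [hαv, g.symm]; exact key
    convert key' using 4 <;> first | exact hb | rfl
  have hpos : 0 < g.val q (deriv β 0) (β 0) := lt_of_lt_of_eq hrhs hgauss.symm
  -- hence `d f(α u)/du > 0` at `u = 0`
  have hfα : HasDerivAt (fun u ↦ f (α u))
      (0 - (-(2 * g.val q (deriv β 0) (β 0)) / (2 * Real.sqrt (-Q (α 0))))) 0 := by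
    have h1 : HasDerivAt (fun u ↦ -Q (α u)) (-(2 * g.val q (deriv β 0) (β 0))) 0 := hQα.neg
    have h2 := h1.sqrt (by rw [hα0]; exact hQ₀'.ne')
    exact (hasDerivAt_const (0 : ℝ) a).sub h2
  have hderiv : 0 < deriv (fun u ↦ f (α u)) 0 := by
    rw [hfα.deriv, hα0]
    have hs : 0 < Real.sqrt (-Q p₀) := Real.sqrt_pos.2 hQ₀'
    have h3 : 0 < 2 * g.val q (deriv β 0) (β 0) / (2 * Real.sqrt (-Q p₀)) :=
      div_pos (by linarith) (by linarith)
    have h4 : (0 : ℝ) - -(2 * g.val q (deriv β 0) (β 0)) / (2 * Real.sqrt (-Q p₀)) =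
        2 * g.val q (deriv β 0) (β 0) / (2 * Real.sqrt (-Q p₀)) := by ring
    rw [h4]
    exact h3
  -- and `df_{p₀}(v) = d f(α u)/du`
  have hchain : mfderiv I 𝓘(ℝ, ℝ) f p₀ v = deriv (fun u ↦ f (α u)) 0 := by
    have hfd' : MDifferentiableAt I 𝓘(ℝ, ℝ) f (α 0) := by rw [hα0]; exact hfd
    have h1 : mfderiv 𝓘(ℝ, ℝ) 𝓘(ℝ, ℝ) (f ∘ α) 0 = (mfderiv I 𝓘(ℝ, ℝ) f (α 0)).comp
        (mfderiv 𝓘(ℝ, ℝ) I α 0) := mfderiv_comp 0 (g := f) (f := α) hfd' hαd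
    have h2 : mfderiv 𝓘(ℝ, ℝ) 𝓘(ℝ, ℝ) (f ∘ α) 0 1 = mfderiv I 𝓘(ℝ, ℝ) f (α 0) (velocity I α 0) := by
      rw [h1]; rfl
    rw [hαv, hα0] at h2
    rw [← h2, mfderiv_eq_fderiv]
    rfl
  show (0 : ℝ) < mfderiv I 𝓘(ℝ, ℝ) f p₀ v
  rw [hchain]
  exact hderiv

end LorentzianMetric

end Literature.Geometry.Lorentzian

end
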